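import Summits.HodgeConjecture.HodgeConjecture.Theorems.MarkmanPartnerTransportK3Sq2OneCycleIsometries

/-!
# Route MarkmanPartnerTransport · crux #5 `LowPicardRealMultiplication` — the hypothesis
# `¬ SpannedByIsometries` means GENUINE REAL MULTIPLICATION

The crux `LowPicardRealMultiplication` (stmt-HodgeConjecture-19653) is stated under `¬ SpannedByIsometries X φ`.
This file identifies that hypothesis, on the period datum of a marked smooth projective `K3^{[2]}`-type `X`
(`…K3Sq2PeriodDatum`, `…LatticeBridge*`; `E = End_Hdg(T(X)_ℚ)` a number field by Zarhin), with the
real-multiplication regime: if the transcendental Hodge endomorphisms of `H²(X)` are NOT spanned by isometries then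
`E` is neither `ℚ` (every Hodge endomorphism would be a rational scalar on `T(X)`, spanned by the identity) nor a
CM field (complex multiplication forces `SpannedByIsometries`, `spannedByIsometries_of_cm`), hence a totally real
field `≠ ℚ`, and an element `r ∈ E ∖ ℚ` extended by `id_N` is a rational, type-preserving endomorphism of
`H²(X(ℂ); ℂ)` acting on the symplectic form by the REAL IRRATIONAL number `ε(r)`:

* `exists_realMultiplication_of_not_spannedByIsometries` — `¬ SpannedByIsometries X φ ⇒` there is a rational,
  type-preserving endomorphism `e` of `H²(X(ℂ); ℂ)` with `e σ = ev · σ`, `ev ∈ ℝ ∖ ℚ`.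

Together with `…K3Sq2OneCycleFifth` this pins the content of crux #5 down to: «when `X` (with `ρ(X) ≤ 3`) has
genuine real multiplication, SOME real-multiplication endomorphism generating `E` is induced by an algebraic
class on `X × X`». No definition, no sorry, no named-fact hypothesis. Prover seat hodge-nonav-19652-p1 (gen 8),
`--supports stmt-HodgeConjecture-19653`. Nothing here proves the crux or HC.

References: Zarhin, J. reine angew. Math. 341 (1983) Thm. 1.5.1, Thm. 1.6; van Geemen, Michigan Math. J. 56 (2008)
§2; Huybrechts, *Lectures on K3 Surfaces*, Ch. 3 Thm. 3.3.7.
-/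

noncomputable section

set_option linter.dupNamespace false

open scoped TensorProduct
open Module CategoryTheory
open Literature.AlgebraicTopology.SingularHomology Literature.Geometry.Kaehler
open Literature.AlgebraicGeometry Literature.AlgebraicGeometry.Motives Literature.AlgebraicGeometry.HodgeTheory
open Literature.AlgebraicGeometry.Motives.HodgeStructure
open Literature.AlgebraicGeometry.Hyperkaehler Literature.AlgebraicGeometry.Surfaces
open Summit.HodgeConjecture.HodgeConjecture.Theorems.NikulinTwinTransport
open Summit.HodgeConjecture.HodgeConjecture.Theorems.MarkmanPartnerTransport.BBFPositivity
open Summit.HodgeConjecture.HodgeConjecture.Theorems.MarkmanPartnerTransport.LatticeBridge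

namespace Summit.HodgeConjecture.HodgeConjecture.Theorems.MarkmanPartnerTransport.PartnerLattice

/-- `MarkedK3Sq[X, φ, P, z]`: VERBATIM the `let MarkedK3Sq := …` binder of the route declarations of
MarkmanPartnerTransport (clauses (m1)–(m6)). Local notation only. -/
local notation3 (prettyPrint := false) "MarkedK3Sq[" X ", " φ ", " P ", " z "]" =>
  (((IsIntegralClass P ∧ ∀ Q : complexBetti X (2 * 4), IsIntegralClass Q → ∃ n : ℤ, Q = n • P) ∧
    (∀ c : complexBetti X 2, IsIntegralClass c ↔ ∃ v : K3HilbertIndex → ℤ, φ c = fun i => (v i : ℂ)) ∧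
    (∀ a : complexBetti X 2, cupPowTwo a 4 = ((3 : ℂ) * (k3HilbertForm 2 (φ a) (φ a)) ^ 2) • P) ∧
    (IsOfHodgeType 4 X 2 2 0 (LinearEquiv.symm φ z) ∧
      ∀ τ : complexBetti X 2, IsOfHodgeType 4 X 2 2 0 τ → ∃ t : ℂ, τ = t • LinearEquiv.symm φ z) ∧
    (∀ c : complexBetti X 2, IsOfHodgeType 4 X 2 1 1 c ↔
      (k3HilbertForm 2 (φ c) z = 0 ∧ k3HilbertForm 2 (φ c) (star z) = 0)) ∧
    (k3HilbertForm 2 z z = 0 ∧ 0 < (k3HilbertForm 2 (star z) z).re)))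

/-- `SpIso[X, φ]`: VERBATIM the `let SpannedByIsometries := …` binder of the route declarations (with
`IsBBFTransc` unfolded). Local notation only. -/
local notation3 (prettyPrint := false) "SpIso[" X ", " φ "]" =>
  (∀ f : complexBetti X 2 →ₗ[ℂ] complexBetti X 2, (∀ y, IsRationalClass y → IsRationalClass (f y)) →
    (∀ (i j : ℕ) y, IsOfHodgeType 4 X 2 i j y → IsOfHodgeType 4 X 2 i j (f y)) →
    (∀ d : complexBetti X 2, d ∈ algebraicClasses X 1 → f d = 0) →
    (∀ y : complexBetti X 2, ∀ d : complexBetti X 2, d ∈ algebraicClasses X 1 →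
      k3HilbertForm 2 (φ (f y)) (φ d) = 0) →
    ∃ (k : ℕ) (c : Fin k → ℚ) (g : Fin k → (complexBetti X 2 →ₗ[ℂ] complexBetti X 2)),
      (∀ i, Function.Bijective (g i) ∧ (∀ y, IsRationalClass y → IsRationalClass (g i y)) ∧
        (∀ (a b : ℕ) y, IsOfHodgeType 4 X 2 a b y → IsOfHodgeType 4 X 2 a b (g i y)) ∧
        (∀ a b, k3HilbertForm 2 (φ (g i a)) (φ (g i b)) = k3HilbertForm 2 (φ a) (φ b))) ∧
      ∀ y : complexBetti X 2, (∀ d : complexBetti X 2, d ∈ algebraicClasses X 1 →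
        k3HilbertForm 2 (φ y) (φ d) = 0) → f y = ∑ i : Fin k, ((c i : ℂ) • g i y))

/-- `qQ`: the rational Beauville–Bogomolov form on `ℚ²³`. -/
local notation3 (prettyPrint := false) "qQ" => Matrix.toBilin' (Matrix.map (k3HilbertGram 2) (Int.cast : ℤ → ℚ))

/-- `qC`: the complex Beauville–Bogomolov form on `ℂ²³`. -/
local notation3 (prettyPrint := false) "qC" => Matrix.toBilin' (Matrix.map (k3HilbertGram 2) (Int.cast : ℤ → ℂ))

variable {X : SchemeOver ℂ} {φ : complexBetti X 2 ≃ₗ[ℂ] (K3HilbertIndex → ℂ)} {P : complexBetti X (2 * 4)}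
  {z : K3HilbertIndex → ℂ}

/-- **`¬ SpannedByIsometries` means genuine real multiplication** (module docstring): for a marked smooth
projective `K3^{[2]}`-type `X` whose transcendental Hodge endomorphisms are not spanned by isometries there is a
rational, type-preserving endomorphism `e` of `H²(X(ℂ); ℂ)` acting on `σ = φ⁻¹ z` by a real irrational number.
Proof on the period datum: if `E = End_Hdg(T(X)_ℚ)` had a non-real `(2,0)`-character value, Zarhin's adjoint
theorem would give complex multiplication and `spannedByIsometries_of_cm` the spanning; if `E = ℚ` every Hodge
endomorphism is a rational scalar on `T(X)`, spanned by the identity; so `E` is totally real with an element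
`r ∉ ℚ`, and `e = φ⁻¹ ∘ (r ⊕ id_N)_ℂ ∘ φ` (`extendT`, `typePreserving_of_markedSq`).
[cite: Zarhin1983HodgeGroupsK3, Thm. 1.5.1 and Thm. 1.6] [cite: Vangeemen2008, §2] -/
theorem exists_realMultiplication_of_not_spannedByIsometries (hX : IsSmoothProjective 4 X)
    (hM : MarkedK3Sq[X, φ, P, z]) (hnsp : ¬ SpIso[X, φ]) :
    ∃ e : complexBetti X 2 →ₗ[ℂ] complexBetti X 2, (∀ y, IsRationalClass y → IsRationalClass (e y)) ∧
      (∀ (i j : ℕ) y, IsOfHodgeType 4 X 2 i j y → IsOfHodgeType 4 X 2 i j (e y)) ∧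
      ∃ ev : ℂ, e (φ.symm z) = ev • φ.symm z ∧ ev.im = 0 ∧ ∀ a : ℚ, (a : ℂ) ≠ ev := by
  classical
  obtain ⟨-, hint, -, ⟨hz20, hz20'⟩, h11, hzz, hzpos⟩ := id hM
  obtain ⟨NQ, hNQ⟩ := exists_ratNeronSeveri (X := X) φ
  set D := periodDatum hX hM hNQ with hDdef
  have hDT : D.T = (qQ).orthogonal NQ := rfl
  have hDx : D.x = z := rfl
  have hDBC : ∀ a b, D.BC a b = k3HilbertForm 2 a b := fun a b => qC_apply a b
  clear_value D
  have hzne : z ≠ 0 := by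
    intro h0
    rw [h0, k3HilbertForm_eq_dotProduct] at hzpos
    simp at hzpos
  set H := D.hodgeT with hH
  have hK3 : H.IsOfK3Type := D.isOfK3Type_hodgeT
  have hirr : H.IsIrreducible := D.isIrreducible_hodgeT
  set ψ : H.Polarization := D.polT with hψ
  obtain ⟨hFld, ε, hεinj, hε⟩ := Zarhin1983_endAlg_isField_holds H hirr hK3
  have hω : D.omega ∈ H.piece 2 0 := D.omega_mem_piece
  have hrat : ∀ c, IsRationalClass c ↔ ∃ w : K3HilbertIndex → ℚ, φ c = fun i => (w i : ℂ) :=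
    isRationalClass_iff_of_markedSq hX hint
  -- an element `u ∈ E` extended by `id_N` as an endomorphism of `H²(X)`: rational, type-preserving, `σ ↦ ε(u) σ`
  have ext : ∀ u : H.endAlg, ∃ e : complexBetti X 2 →ₗ[ℂ] complexBetti X 2,
      (∀ y, IsRationalClass y → IsRationalClass (e y)) ∧
      (∀ (i j : ℕ) y, IsOfHodgeType 4 X 2 i j y → IsOfHodgeType 4 X 2 i j (e y)) ∧
      e (φ.symm z) = ε u • φ.symm z := by
    intro u
    set û : Module.End ℚ (K3HilbertIndex → ℚ) := D.extendT (u : Module.End ℚ ↥D.T) with hû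
    have hûz : cxEnd û z = ε u • z := by
      have h := hε u D.omega hω
      have h2 := congrArg (iota D.T) h
      rw [D.iota_baseChange, D.iota_omega, map_smul, D.iota_omega, hDx] at h2
      exact h2
    have hû11 : ∀ w : K3HilbertIndex → ℂ, k3HilbertForm 2 w z = 0 → k3HilbertForm 2 w (star z) = 0 →
        k3HilbertForm 2 (cxEnd û w) z = 0 ∧ k3HilbertForm 2 (cxEnd û w) (star z) = 0 := by
      intro w h1 h2
      have h := D.BC_cxEnd_extendT u.2 (z := w) (by rw [hDBC, hDx]; exact h1) (by rw [hDBC, hDx]; exact h2)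
      rwa [hDBC, hDBC, hDx] at h
    refine ⟨φ.symm.toLinearMap ∘ₗ cxEnd û ∘ₗ φ.toLinearMap, ?_, ?_, ?_⟩
    · intro y hy
      obtain ⟨w, hw⟩ := (hrat y).1 hy
      rw [LinearMap.comp_apply, LinearMap.comp_apply, LinearEquiv.coe_coe, LinearEquiv.coe_coe, hw, cxEnd_ratVec]
      exact (hrat _).2 ⟨û w, LinearEquiv.apply_symm_apply _ _⟩
    · intro i j y hy
      exact typePreserving_of_markedSq hX hM (cxEnd û) (cxEnd_star û) ⟨ε u, hûz⟩ hû11 i j y hy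
    · rw [LinearMap.comp_apply, LinearMap.comp_apply, LinearEquiv.coe_coe, LinearEquiv.coe_coe,
        LinearEquiv.apply_symm_apply, hûz, map_smul]
  by_cases hreal : ∀ (φ' : H.endAlg →+* ℂ) (a : H.endAlg), starRingEnd ℂ (φ' a) = φ' a
  · -- `E` totally real; it is not `ℚ`, for then every Hodge endomorphism would be a rational scalar on `T(X)`
    by_cases hbot : ∀ s : H.endAlg, s ∈ (⊥ : Subalgebra ℚ H.endAlg)
    · exfalso
      apply hnsp
      intro f hf_rat hf_typ _ _
      obtain ⟨τf, hτfM, hτfx, hτf11⟩ := exists_ratEnd_of_hodgeEndomorphism hX hM f hf_rat hf_typ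
      have hτfx' : ∃ c : ℂ, cxEnd τf D.x = c • D.x := by rw [hDx]; exact hτfx
      have hτf11' : ∀ w : K3HilbertIndex → ℂ, D.BC w D.x = 0 → D.BC w (star D.x) = 0 →
          D.BC (cxEnd τf w) D.x = 0 ∧ D.BC (cxEnd τf w) (star D.x) = 0 := by
        intro w h1 h2
        rw [hDBC, hDx] at h1 h2
        rw [hDBC, hDBC, hDx]
        exact hτf11 w h1 h2
      have hτfT : ∀ t ∈ D.T, τf t ∈ D.T := fun t ht => D.map_mem_T τf hτfx' ht
      have hrf : τf.restrict hτfT ∈ H.endAlg := D.restrict_mem_endAlg τf hτfT hτfx' hτf11'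
      obtain ⟨a, ha⟩ := Algebra.mem_bot.1 (hbot ⟨τf.restrict hτfT, hrf⟩)
      -- `τf = a` on `T`
      have hTeq : ∀ t' : ↥D.T, τf (t' : K3HilbertIndex → ℚ) = a • (t' : K3HilbertIndex → ℚ) := by
        intro t'
        have h1 := congrArg (fun s : H.endAlg => ((s : Module.End ℚ ↥D.T) t' : K3HilbertIndex → ℚ)) ha
        simp only [Subalgebra.coe_algebraMap, Module.algebraMap_end_apply, Submodule.coe_smul,
          LinearMap.coe_restrict_apply] at h1
        exact h1.symm
      have hτfMapp : ∀ v, cxEnd τf v = φ (f (φ.symm v)) := fun v => by rw [hτfM]; rfl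
      have hcx : ∀ w : ℂ ⊗[ℚ] ↥D.T, cxEnd τf (iota _ w) = ((a : ℚ) : ℂ) • iota _ w := by
        intro w
        induction w using TensorProduct.induction_on with
        | zero => rw [map_zero, map_zero, smul_zero]
        | tmul b t' => rw [iota_tmul, map_smul, cxEnd_ratVec, hTeq t', ratCastVec_smul, smul_comm]
        | add z₁ z₂ h₁ h₂ => rw [map_add, map_add, h₁, h₂, smul_add]
      refine ⟨1, fun _ => a, fun _ => LinearMap.id, fun _ => ⟨Function.bijective_id, fun y hy => hy,
        fun _ _ y hy => hy, fun _ _ => rfl⟩, fun y hy => ?_⟩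
      have hyT : φ y ∈ Submodule.span ℂ (Set.range fun t : ↥D.T => fun i => (((t : K3HilbertIndex → ℚ) i : ℚ) : ℂ)) := by
        have h := (mem_span_ratTransc_iff hX hint hNQ (φ y)).2 hy
        rw [Set.image_eq_range] at h
        rw [hDT]
        exact h
      have hz : iota _ (lam D.isCompl (φ y)) = φ y := iota_lam_of_mem_span D.isCompl hyT
      have hfy : f y = φ.symm (cxEnd τf (φ y)) := by
        rw [hτfMapp, LinearEquiv.symm_apply_apply, LinearEquiv.symm_apply_apply]
      rw [Fin.sum_univ_one, LinearMap.id_apply, hfy, ← hz, hcx, map_smul, hz, LinearEquiv.symm_apply_apply]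
    · -- an element `r ∈ E ∖ ℚ`: its `(2,0)`-character value is real and irrational
      push Not at hbot
      obtain ⟨r, hr⟩ := hbot
      obtain ⟨e, he_rat, he_typ, he_ev⟩ := ext r
      refine ⟨e, he_rat, he_typ, ε r, he_ev, ?_, fun a ha => hr ?_⟩
      · have h := hreal ε.toRingHom r
        change starRingEnd ℂ (ε r) = ε r at h
        exact Complex.conj_eq_iff_im.1 h
      · rw [Algebra.mem_bot]
        refine ⟨a, hεinj ?_⟩
        rw [AlgHom.commutes, eq_ratCast, ha]
  · -- `E` has a non-real character value: complex multiplication, which forces `SpannedByIsometries`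
    exfalso
    push Not at hreal
    obtain ⟨φ', a, hφ'a⟩ := hreal
    obtain ⟨hadjex, hadjconj⟩ := Zarhin1983_adjoint_eq_conj_holds H hirr hK3 ψ
    obtain ⟨a', ha'⟩ := hadjex a
    have hne : a' ≠ a := by
      intro h
      apply hφ'a
      have key := hadjconj a a' ha' φ'
      rw [h] at key
      exact key.symm
    have hμ : (ε a).im ≠ 0 := by
      intro him
      apply hne
      apply hεinj
      have key := hadjconj a a' ha' ε.toRingHom
      change ε a' = starRingEnd ℂ (ε a) at key
      rw [key]
      exact Complex.conj_eq_iff_im.2 him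
    obtain ⟨Ψ, hΨrat, hΨtyp, hΨσ⟩ := ext a
    exact hnsp (spannedByIsometries_of_cm hX hM Ψ hΨrat (fun y hy => hΨtyp 1 1 y hy) hΨσ hμ)

end Summit.HodgeConjecture.HodgeConjecture.Theorems.MarkmanPartnerTransport.PartnerLattice

end
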